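import Mathlib
import Summits.QuantumFields.YangMills.Theorems.CoarseStiffnessTailCappedCoarseStiffnessLLargeFieldCount
import Summits.QuantumFields.YangMills.Theorems.CoarseStiffnessTailCappedCoarseStiffnessLLogStiffness
import Summits.QuantumFields.YangMills.Theorems.CoarseStiffnessTailCappedCoarseStiffnessLBareLogStiffness

/-!
# Route `CoarseStiffnessTail` — THE LINE'S LEVER WITHOUT ANY SMALL-FIELD CONTENT, file 2 of 2: LargeFieldCount ⇒ `UnitScaleTilt.HistoryTailL`;
# the crux and LogStiffness imply LargeFieldCount; its bare face holds (lead's certificate, seat `ym-line-cst-p1` g5; helper on crux 25301)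

Continuation of `CoarseStiffnessTailCappedCoarseStiffnessLLargeFieldCount` (the count `N_j(U) = #{a ∈ Plaq_j : θ(K−j) ≤ |Ū^j(∂a) − 1|}`, its domination
by the capped stiffness, and «count exponential moment ⇔ joint Peierls bound»).  Here, with the hypothesis (constants per `(F, γ)`)

  LargeFieldCount := `∀ L b₀ p₀ (0 < b₀, 2 < p₀) ∃ γ₁ ∈ (0,1] ∀ F γ (F.L = L, 0 < γ ≤ γ₁) ∃ c₀ > 0, C₀, A : ℕ ∀ K j (j ≤ K):`
  `∫ exp(c₀·p(g_{K−j})²·N_j) dGibbs_K ≤ exp((C₀ + A·log β_{K−j})·#Plaq_j)`     (`p = B10.pFun b₀ p₀`, `g_i = √(γL^{−i})`, `β_i = (γL^{−i})⁻¹`),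

written out in full (no `def`):

* §4 **`perPlaquette_of_largeFieldCount`**: LargeFieldCount for one `(F, γ)` ⇒ the per-plaquette schema `e^{9000L³|C₀|}·β^{9000L³A}·e^{−c₀p(g)²}`
  (chessboard `chessboardRP_T3` at `ρ = 1`, then `jointPeierls_of_count` on the chessboard family, then the `1/|S|`-th root with `#Plaq_j ≤ 9000L³|S|`
  — verbatim the bookkeeping of `CoarseStiffnessTailLogStiffness.perPlaquette_of_logStiffness`, p633005, with the count in place of `X_j`);
  **`historyTailL_of_largeFieldCount`**: LargeFieldCount ⇒ `UnitScaleTilt.HistoryTailL` BY NAME (`T3AveragedTailProfile.historyTailAt_of_perPlaquette`);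
  **`largeFieldCount_of_logStiffness`**, **`largeFieldCount_of_cappedCoarseStiffnessL`** — so the kernel chain of sufficient conditions for 19936
  along this route now reads  `CappedCoarseStiffnessL (25301) ⇒ LogStiffness ⇒ LargeFieldCount ⇒ HistoryTailL (19936)`;
* §5 **`bare_largeFieldCount`**: the `j = 0` face of LargeFieldCount HOLDS unconditionally, absolute `C`, `A = 2` (from `bare_logStiffness_nat`, p633095).

READING (for planners).  LargeFieldCount is strictly weaker than LogStiffness (no sub-threshold content at all: in Bałaban's language only the
R-operation's small factors `e^{−¼p(g)²}` per large plaquette, [Balaban1985UV3] (71) p.273, summed over all large-field sets against an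
`e^{O(1)|T^{(j)}|}` allowance — items 1–4 of the card's §Hardest stub drop out, item 5 remains) and has the same payoff for rung R3; a planner may
re-type 25301 accordingly (D-0019; not the lead's call).  By `…LargeFieldCount` §3 it is the joint Peierls bound for ALL subfamilies at rate
`c₀p(g)²` — the owner's `BirthV5q.stub_jointRateHigh` (dilute families, uniform constants, slack `C·x_j·N_j³`) is the same located content.

HONEST SCOPE.  Conditional certificates and one elementary bare face; NOTHING of Bałaban's estimates is proved: LargeFieldCount at `j ≥ 1`,
LogStiffness, the crux 25301 and `HistoryTailL` 19936 stay OPEN; `YM3TorusSU2` (rung R3, a RECORD rung, not the Clay statement) is NOT proved; the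
Yang–Mills mass gap is NOT touched.

References: J. Fröhlich, R. Israel, E. Lieb, B. Simon, CMP **62** (1978) 1–34 [FrohlichIsraelLiebSimon1978] (Thm 4.1, chessboard); T. Bałaban,
CMP **102** (1985) 255–275 [Balaban1985UV3] ((7) p.257, (71) p.273).
-/

noncomputable section

namespace Summit.QuantumFields.YangMills.Theorems.CoarseStiffnessTailLargeFieldCountGlue

open MeasureTheory ProbabilityTheory Finset
open Literature.MathematicalPhysics.QuantumFieldTheory
open Literature.MathematicalPhysics.QuantumFieldTheory.Balaban1983to89
open Literature.MathematicalPhysics.QuantumFieldTheory.Balaban1983to89.T3ContinuumYM3Torus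
open Literature.MathematicalPhysics.QuantumFieldTheory.Balaban1983to89.T3UnitScaleTilt
open Literature.MathematicalPhysics.QuantumFieldTheory.Balaban1983to89.T3UnitLawDensityEML
open Literature.MathematicalPhysics.QuantumFieldTheory.Balaban1983to89.T3AveragedTailProfile
open Summit.QuantumFields.YangMills.Theorems.HistoryTailChessboardT3 (chessboardRP_T3)
open Summit.QuantumFields.YangMills.Theorems.CoarseStiffnessTailHistoryTailOfStiffness (card_plaq_le_of_chessboard)
open Summit.QuantumFields.YangMills.Theorems.CoarseStiffnessTailLogStiffness (logStiffness_of_cappedCoarseStiffnessL)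
open Summit.QuantumFields.YangMills.Theorems.CoarseStiffnessTailBareLogStiffness (bare_logStiffness_nat)
open Summit.QuantumFields.YangMills.Theorems.CoarseStiffnessTailLargeFieldCount (jointPeierls_of_count integral_exp_count_le)

/-! ## §4 LargeFieldCount ⇒ the per-plaquette schema ⇒ `HistoryTailL`; the crux and LogStiffness imply LargeFieldCount -/

section Glue

variable (F : T3Family)

/-- **THE PER-PLAQUETTE SCHEMA FROM THE LARGE-FIELD COUNT** (one family `F`, one coupling `0 < γ ≤ 1`, `0 < c₀`; any profile): if
`∫ exp(c₀·p(g_{K−j})²·N_j) dGibbs_K ≤ exp((C₀ + A·log β_{K−j})·#Plaq_j)` for all `j ≤ K`, then every level-`j` averaged plaquette has the Gibbs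
tail `Gibbs_K{θ(K−j) ≤ |Ū^j(∂p) − 1|} ≤ e^{9000L³|C₀|}·β_{K−j}^{9000L³A}·exp(−c₀·p(g_{K−j})²)`: chessboard (`chessboardRP_T3`, `ρ = 1`) reduces to
the joint event of the chessboard family `S`, §3 `jointPeierls_of_count` bounds it by `e^{−c₀p²|S|}·e^{(C₀ + A log β)#Plaq_j}`, and the
`1/|S|`-th root costs `#Plaq_j/|S| ≤ 9000L³`.  Same constants as `CoarseStiffnessTailLogStiffness.perPlaquette_of_logStiffness`.
[cite: FrohlichIsraelLiebSimon1978, Thm 4.1] -/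
theorem perPlaquette_of_largeFieldCount {γ b₀ p₀ c₀ C₀ : ℝ} {A : ℕ} (hγ : 0 < γ) (hγ1 : γ ≤ 1) (hc₀ : 0 < c₀)
    (hN : ∀ (K j : ℕ), j ≤ K →
      ∫ U, Real.exp (c₀ * B10.pFun b₀ p₀ (Real.sqrt (γ * ((F.L : ℝ)⁻¹) ^ (K - j))) ^ 2 *
          ∑ a : Plaq (F.P K) j, (if θBal F.L γ b₀ p₀ (K - j) ≤ GaugeGroup.dist1 (GaugeField.plaqHol
            (Averaging.iter (fun i => BlockAveraging.blockAvg (P := F.P K) (j := i) ℰp) j U) a) then (1 : ℝ) else 0))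
          ∂(gibbsK F ℰp γ K) ≤
        Real.exp ((C₀ + A * Real.log ((γ * ((F.L : ℝ)⁻¹) ^ (K - j))⁻¹)) * (Fintype.card (Plaq (F.P K) j) : ℝ))) :
    ∀ (K j : ℕ), 1 ≤ j → j ≤ K → ∀ p : Plaq (F.P K) j,
      (gibbsK F ℰp γ K).real
          {U | θBal F.L γ b₀ p₀ (K - j) ≤
            GaugeGroup.dist1 (GaugeField.plaqHol
              (Averaging.iter (fun i => BlockAveraging.blockAvg (P := F.P K) (j := i) ℰp) j U) p)} ≤
        Real.exp (9000 * (F.L : ℝ) ^ 3 * |C₀|) * (F.scheme ℰp γ).β (K - j) ^ (9000 * F.L ^ 3 * A) *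
          Real.exp (-(c₀ * B10.pFun b₀ p₀ (Real.sqrt (γ * ((F.L : ℝ)⁻¹) ^ (K - j))) ^ 2)) := by
  intro K j _hj1 hjK p
  haveI := isProbabilityMeasure_gibbsK F ℰp hγ.le K
  have hL1 : 1 < F.L := F.hL.2
  set θ : ℝ := θBal F.L γ b₀ p₀ (K - j) with hθdef
  set β : ℝ := (γ * ((F.L : ℝ)⁻¹) ^ (K - j))⁻¹ with hβdef
  have hβ1 : 1 ≤ β := by
    have hL1' : (1 : ℝ) ≤ F.L := by exact_mod_cast F.hL.2.le
    have hL0' : (0 : ℝ) < F.L := lt_of_lt_of_le one_pos hL1'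
    have hpos' : 0 < γ * ((F.L : ℝ)⁻¹) ^ (K - j) := mul_pos hγ (pow_pos (inv_pos.mpr hL0') _)
    have hle' : γ * ((F.L : ℝ)⁻¹) ^ (K - j) ≤ 1 :=
      (mul_le_of_le_one_right hγ.le (pow_le_one₀ (inv_nonneg.mpr hL0'.le) (inv_le_one_of_one_le₀ hL1'))).trans hγ1
    exact (one_le_inv₀ hpos').mpr hle'
  have hβ0 : 0 < β := lt_of_lt_of_le one_pos hβ1
  have hlogβ : 0 ≤ Real.log β := Real.log_nonneg hβ1
  have hβeq : (F.scheme ℰp γ).β (K - j) = β := rfl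
  set psq : ℝ := B10.pFun b₀ p₀ (Real.sqrt (γ * ((F.L : ℝ)⁻¹) ^ (K - j))) ^ 2 with hpsqdef
  have hpsq0 : 0 ≤ psq := sq_nonneg _
  -- the logarithmic constant at this height, and its nonnegative majorant
  set C₁ : ℝ := C₀ + A * Real.log β with hC₁def
  set M : ℝ := |C₀| + A * Real.log β with hMdef
  have hM0 : 0 ≤ M := add_nonneg (abs_nonneg _) (mul_nonneg (Nat.cast_nonneg _) hlogβ)
  have hC₁M : C₁ ≤ M := by
    rw [hC₁def, hMdef]
    linarith [le_abs_self C₀]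
  -- the chessboard family at separation `ρ = 1`
  obtain ⟨S, hpS, -, hcount, hchess⟩ :=
    chessboardRP_T3 F.L F.hL.1 hL1 F γ rfl hγ hγ1 θ K j hjK 1 le_rfl p
  have hS0 : 0 < S.card := Finset.card_pos.mpr ⟨p, hpS⟩
  have hS0R : (0 : ℝ) < (S.card : ℝ) := by exact_mod_cast hS0
  -- §3: joint Peierls for the family `S` at rate `t = c₀ p²`
  set t : ℝ := c₀ * psq with htdef
  have ht0 : 0 ≤ t := mul_nonneg hc₀.le hpsq0
  have hjoint : (gibbsK F ℰp γ K).real {U | ∀ q ∈ S, θ ≤ GaugeGroup.dist1 (GaugeField.plaqHol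
        (Averaging.iter (fun _ => BlockAveraging.blockAvg ℰp) j U) q)} ≤
      Real.exp (-t * (S.card : ℝ)) * Real.exp (C₁ * (Fintype.card (Plaq (F.P K) j) : ℝ)) :=
    jointPeierls_of_count F hγ.le K j θ ht0 (hN K j hjK) S
  -- take the `1/|S|`-th power
  have hbase0 : 0 ≤ (gibbsK F ℰp γ K).real {U | ∀ q ∈ S, θ ≤ GaugeGroup.dist1 (GaugeField.plaqHol
        (Averaging.iter (fun _ => BlockAveraging.blockAvg ℰp) j U) q)} := measureReal_nonneg
  have hexpS : 0 ≤ (1 : ℝ) / (S.card : ℝ) := by positivity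
  have hpow := Real.rpow_le_rpow hbase0 hjoint hexpS
  have hrhs : (Real.exp (-t * (S.card : ℝ)) * Real.exp (C₁ * (Fintype.card (Plaq (F.P K) j) : ℝ))) ^
        ((1 : ℝ) / (S.card : ℝ)) =
      Real.exp (-t + C₁ * (Fintype.card (Plaq (F.P K) j) : ℝ) / (S.card : ℝ)) := by
    rw [← Real.exp_add, ← Real.exp_mul]
    congr 1
    field_simp
  rw [hrhs] at hpow
  refine (hchess.trans hpow).trans ?_
  -- the constants: `C₁ #Plaq_j / |S| ≤ 9000 L³ M`
  have hcard : (Fintype.card (Plaq (F.P K) j) : ℝ) ≤ 9000 * (F.L : ℝ) ^ 3 * (S.card : ℝ) :=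
    card_plaq_le_of_chessboard F K j hcount
  have hC : C₁ * (Fintype.card (Plaq (F.P K) j) : ℝ) / (S.card : ℝ) ≤ 9000 * (F.L : ℝ) ^ 3 * M := by
    rw [div_le_iff₀ hS0R]
    have h1 : C₁ * (Fintype.card (Plaq (F.P K) j) : ℝ) ≤ M * (Fintype.card (Plaq (F.P K) j) : ℝ) :=
      mul_le_mul_of_nonneg_right hC₁M (Nat.cast_nonneg _)
    have h2 : M * (Fintype.card (Plaq (F.P K) j) : ℝ) ≤ M * (9000 * (F.L : ℝ) ^ 3 * (S.card : ℝ)) :=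
      mul_le_mul_of_nonneg_left hcard hM0
    nlinarith
  -- `exp(9000L³·M) = exp(9000L³|C₀|)·β^{9000L³A}`
  have hsplit : Real.exp (9000 * (F.L : ℝ) ^ 3 * M) =
      Real.exp (9000 * (F.L : ℝ) ^ 3 * |C₀|) * β ^ (9000 * F.L ^ 3 * A) := by
    rw [hMdef, mul_add, Real.exp_add]
    congr 1
    rw [show 9000 * (F.L : ℝ) ^ 3 * (A * Real.log β) = ((9000 * F.L ^ 3 * A : ℕ) : ℝ) * Real.log β by push_cast; ring,
      ← Real.log_pow, Real.exp_log (pow_pos hβ0 _)]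
  rw [hβeq, ← hsplit, mul_comm (Real.exp (9000 * (F.L : ℝ) ^ 3 * M)), ← Real.exp_add]
  exact Real.exp_le_exp.mpr (by linarith)

/-- **LARGE-FIELD COUNT ⇒ `UnitScaleTilt.HistoryTailL`** (crux stmt-QuantumFields-19936 of the parent route, BY NAME): the hypothesis
LargeFieldCount — `∀ L b₀ p₀ (0 < b₀, 2 < p₀) ∃ γ₁ ∈ (0,1] ∀ F γ (F.L = L, 0 < γ ≤ γ₁) ∃ c₀ > 0, C₀, A ∀ K j (j ≤ K):`
`∫ exp(c₀·p(g_{K−j})²·#{a ∈ Plaq_j : θ(K−j) ≤ |Ū^j(∂a) − 1|}) dGibbs_K ≤ exp((C₀ + A·log β_{K−j})·#Plaq_j)` — gives `HistoryTailL` at the profile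
`b₀ = max b₁ 1`, `p₀ = max p₁ 3`: `perPlaquette_of_largeFieldCount` fed to the tree's `T3AveragedTailProfile.historyTailAt_of_perPlaquette`.
Conditional certificate: the hypothesis (Bałaban's large-field factors (71) summed over all large-field sets, integrated against the Gibbs law)
is OPEN; no rung or summit is proved. [cite: Balaban1985UV3, (7) p.257 and (71) p.273] -/
theorem historyTailL_of_largeFieldCount
    (hLFC : ∀ (L : ℕ) (b₀ p₀ : ℝ), 0 < b₀ → 2 < p₀ → ∃ γ₁ : ℝ, 0 < γ₁ ∧ γ₁ ≤ 1 ∧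
      ∀ (F : T3Family) (γ : ℝ), F.L = L → 0 < γ → γ ≤ γ₁ → ∃ (c₀ C₀ : ℝ) (A : ℕ), 0 < c₀ ∧
        ∀ (K j : ℕ), j ≤ K →
          ∫ U, Real.exp (c₀ * B10.pFun b₀ p₀ (Real.sqrt (γ * ((F.L : ℝ)⁻¹) ^ (K - j))) ^ 2 *
              ∑ a : Plaq (F.P K) j, (if T3UnitScaleTilt.θBal F.L γ b₀ p₀ (K - j) ≤ GaugeGroup.dist1 (GaugeField.plaqHol
                (Averaging.iter (fun i => BlockAveraging.blockAvg (P := F.P K) (j := i) T3UnitLawDensityEML.ℰp) j U) a)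
                then (1 : ℝ) else 0)) ∂(T3UnitScaleTilt.gibbsK F T3UnitLawDensityEML.ℰp γ K) ≤
            Real.exp ((C₀ + A * Real.log ((γ * ((F.L : ℝ)⁻¹) ^ (K - j))⁻¹)) * (Fintype.card (Plaq (F.P K) j) : ℝ))) :
    Summit.QuantumFields.YangMills.Theses.UnitScaleTilt.HistoryTailL := by
  intro L b₁ p₁
  refine ⟨max b₁ 1, max p₁ 3, le_max_left _ _, le_max_left _ _, lt_of_lt_of_le one_pos (le_max_right _ _),
    lt_of_lt_of_le (by norm_num) (le_max_right _ _), fun m hm => ?_⟩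
  have hb₀ : 0 < max b₁ 1 := lt_of_lt_of_le one_pos (le_max_right _ _)
  have hp₀ : 2 < max p₁ 3 := lt_of_lt_of_le (by norm_num) (le_max_right _ _)
  obtain ⟨γ₁, hγ₁, hγ₁1, hW'⟩ := hLFC L (max b₁ 1) (max p₁ 3) hb₀ hp₀
  refine ⟨γ₁, hγ₁, fun F γ hFL hγ hγγ₁ => ?_⟩
  obtain ⟨c₀, C₀, A, hc₀, hN⟩ := hW' F γ hFL hγ hγγ₁
  have hγ1 : γ ≤ 1 := hγγ₁.trans hγ₁1
  refine historyTailAt_of_perPlaquette F hγ hγ1 hb₀ (by linarith [le_max_right p₁ 3]) hm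
    ⟨Real.exp (9000 * (F.L : ℝ) ^ 3 * |C₀|), 9000 * F.L ^ 3 * A, c₀, (Real.exp_pos _).le, hc₀, ?_⟩
  exact perPlaquette_of_largeFieldCount F hγ hγ1 hc₀ hN

/-- **LogStiffness ⇒ LargeFieldCount** (same constants; §2 `integral_exp_count_le` level by level). [cite: Balaban1985UV3, (7) p.257] -/
theorem largeFieldCount_of_logStiffness
    (hW : ∀ (L : ℕ) (b₀ p₀ : ℝ), 0 < b₀ → 2 < p₀ → ∃ γ₁ : ℝ, 0 < γ₁ ∧ γ₁ ≤ 1 ∧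
      ∀ (F : T3Family) (γ : ℝ), F.L = L → 0 < γ → γ ≤ γ₁ → ∃ (c₀ C₀ : ℝ) (A : ℕ), 0 < c₀ ∧
        ∀ (K j : ℕ), j ≤ K →
          ∫ U, Real.exp (c₀ * (γ * ((F.L : ℝ)⁻¹) ^ (K - j))⁻¹ *
              ∑ a : Plaq (F.P K) j, min (GaugeGroup.dist1 (GaugeField.plaqHol
                (Averaging.iter (fun i => BlockAveraging.blockAvg (P := F.P K) (j := i) T3UnitLawDensityEML.ℰp) j U) a) ^ 2)
                (T3UnitScaleTilt.θBal F.L γ b₀ p₀ (K - j) ^ 2)) ∂(T3UnitScaleTilt.gibbsK F T3UnitLawDensityEML.ℰp γ K) ≤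
            Real.exp ((C₀ + A * Real.log ((γ * ((F.L : ℝ)⁻¹) ^ (K - j))⁻¹)) * (Fintype.card (Plaq (F.P K) j) : ℝ))) :
    ∀ (L : ℕ) (b₀ p₀ : ℝ), 0 < b₀ → 2 < p₀ → ∃ γ₁ : ℝ, 0 < γ₁ ∧ γ₁ ≤ 1 ∧
      ∀ (F : T3Family) (γ : ℝ), F.L = L → 0 < γ → γ ≤ γ₁ → ∃ (c₀ C₀ : ℝ) (A : ℕ), 0 < c₀ ∧
        ∀ (K j : ℕ), j ≤ K →
          ∫ U, Real.exp (c₀ * B10.pFun b₀ p₀ (Real.sqrt (γ * ((F.L : ℝ)⁻¹) ^ (K - j))) ^ 2 *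
              ∑ a : Plaq (F.P K) j, (if T3UnitScaleTilt.θBal F.L γ b₀ p₀ (K - j) ≤ GaugeGroup.dist1 (GaugeField.plaqHol
                (Averaging.iter (fun i => BlockAveraging.blockAvg (P := F.P K) (j := i) T3UnitLawDensityEML.ℰp) j U) a)
                then (1 : ℝ) else 0)) ∂(T3UnitScaleTilt.gibbsK F T3UnitLawDensityEML.ℰp γ K) ≤
            Real.exp ((C₀ + A * Real.log ((γ * ((F.L : ℝ)⁻¹) ^ (K - j))⁻¹)) * (Fintype.card (Plaq (F.P K) j) : ℝ)) := by
  intro L b₀ p₀ hb₀ hp₀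
  obtain ⟨γ₁, hγ₁, hγ₁1, hW'⟩ := hW L b₀ p₀ hb₀ hp₀
  refine ⟨γ₁, hγ₁, hγ₁1, fun F γ hFL hγ hγγ₁ => ?_⟩
  obtain ⟨c₀, C₀, A, hc₀, hX⟩ := hW' F γ hFL hγ hγγ₁
  refine ⟨c₀, C₀, A, hc₀, fun K j hjK => ?_⟩
  exact (integral_exp_count_le F hγ (hγγ₁.trans hγ₁1) hb₀ hc₀.le K j).trans (hX K j hjK)

/-- **THE CRUX ⇒ LargeFieldCount** (`CappedCoarseStiffnessL ⇒ LogStiffness ⇒ LargeFieldCount`, `A = 0`, constants uniform).  With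
`historyTailL_of_largeFieldCount` the kernel chain of sufficient conditions for 19936 along this route reads
`CappedCoarseStiffnessL (25301) ⇒ LogStiffness ⇒ LargeFieldCount ⇒ HistoryTailL (19936)`. [cite: Balaban1985UV3, (71) p.273] -/
theorem largeFieldCount_of_cappedCoarseStiffnessL
    (h : Summit.QuantumFields.YangMills.Theses.CoarseStiffnessTail.CappedCoarseStiffnessL) :
    ∀ (L : ℕ) (b₀ p₀ : ℝ), 0 < b₀ → 2 < p₀ → ∃ γ₁ : ℝ, 0 < γ₁ ∧ γ₁ ≤ 1 ∧
      ∀ (F : T3Family) (γ : ℝ), F.L = L → 0 < γ → γ ≤ γ₁ → ∃ (c₀ C₀ : ℝ) (A : ℕ), 0 < c₀ ∧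
        ∀ (K j : ℕ), j ≤ K →
          ∫ U, Real.exp (c₀ * B10.pFun b₀ p₀ (Real.sqrt (γ * ((F.L : ℝ)⁻¹) ^ (K - j))) ^ 2 *
              ∑ a : Plaq (F.P K) j, (if T3UnitScaleTilt.θBal F.L γ b₀ p₀ (K - j) ≤ GaugeGroup.dist1 (GaugeField.plaqHol
                (Averaging.iter (fun i => BlockAveraging.blockAvg (P := F.P K) (j := i) T3UnitLawDensityEML.ℰp) j U) a)
                then (1 : ℝ) else 0)) ∂(T3UnitScaleTilt.gibbsK F T3UnitLawDensityEML.ℰp γ K) ≤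
            Real.exp ((C₀ + A * Real.log ((γ * ((F.L : ℝ)⁻¹) ^ (K - j))⁻¹)) * (Fintype.card (Plaq (F.P K) j) : ℝ)) :=
  largeFieldCount_of_logStiffness (logStiffness_of_cappedCoarseStiffnessL h)

end Glue

/-! ## §5 The bare face `j = 0` of LargeFieldCount holds unconditionally -/

section Bare

/-- **THE BARE FACE OF LargeFieldCount** (UNCONDITIONAL, absolute `C`, `A = 2`): for every family `F`, `0 < γ ≤ 1`, `0 < c₀ ≤ 1/4`, `0 < b₀`,
`p₀` and every cut-off `K`, `∫ exp(c₀·p(g_K)²·#{bare plaquettes with |U(∂p) − 1| ≥ θ(K)}) dGibbs_K ≤ exp((C + 2·log β_K)·#Plaq_0)` — from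
the landed bare logarithmic stiffness `bare_logStiffness_nat` (p633095) and §2.  The count currency costs nothing new at `j = 0`.
[cite: Balaban1985UV3, (7) p.257 and (71) p.273] -/
theorem bare_largeFieldCount :
    ∃ C : ℝ, ∀ (F : T3Family) (γ b₀ p₀ c₀ : ℝ), 0 < γ → γ ≤ 1 → 0 < b₀ → 0 < c₀ → c₀ ≤ 1 / 4 → ∀ (K : ℕ),
      ∫ U, Real.exp (c₀ * B10.pFun b₀ p₀ (Real.sqrt (γ * ((F.L : ℝ)⁻¹) ^ (K - 0))) ^ 2 *
          ∑ a : Plaq (F.P K) 0, (if T3UnitScaleTilt.θBal F.L γ b₀ p₀ (K - 0) ≤ GaugeGroup.dist1 (GaugeField.plaqHol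
            (Averaging.iter (fun i => BlockAveraging.blockAvg (P := F.P K) (j := i) T3UnitLawDensityEML.ℰp) 0 U) a)
            then (1 : ℝ) else 0)) ∂(T3UnitScaleTilt.gibbsK F T3UnitLawDensityEML.ℰp γ K) ≤
        Real.exp ((C + ((2 : ℕ) : ℝ) * Real.log ((γ * ((F.L : ℝ)⁻¹) ^ (K - 0))⁻¹)) * (Fintype.card (Plaq (F.P K) 0) : ℝ)) := by
  obtain ⟨C, hC⟩ := bare_logStiffness_nat
  refine ⟨C, fun F γ b₀ p₀ c₀ hγ hγ1 hb₀ hc₀ hc₄ K => ?_⟩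
  exact (integral_exp_count_le F hγ hγ1 hb₀ hc₀.le K 0).trans (hC F γ b₀ p₀ c₀ hγ hγ1 hc₀ hc₄ K)

end Bare

end Summit.QuantumFields.YangMills.Theorems.CoarseStiffnessTailLargeFieldCountGlue

end
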